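import Summits.BirchSwinnertonDyer.BirchSwinnertonDyer.Theorems.GenusKolyvaginAtTwoGenusPrimitiveSupplyAtTwoTwistingPrimeEntangledStrict
import HarnessLib

/-!
# Route `GenusKolyvaginAtTwo`, crux #2 `GenusPrimitiveSupplyAtTwo` (stmt-BirchSwinnertonDyer-22136):
# «`W` SELMER-ENTANGLED» IS DECIDED AT `2N` — a class dying on `Γ_{ℚ(E[4])}` is `2`-Selmer iff it satisfies the Kummer
# conditions at the places over `2` and the bad places

Width seat `bsd-line-gk2-p4` g10, cell `bsd-f1-sign2`; helper (`--supports stmt-BirchSwinnertonDyer-22136`), §49 of the twisting-prime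
series (after `…TwistingPrimeEntangledCriterion`). THEOREMS ONLY: no definition, no named fact, no `sorry`; no item is closed; BSD is not
proved by this.

WHY. By the entanglement criterion (`…TwistingPrimeEntangledCriterion`), a prime Heegner twin of `W` can be entangled only if `Sel₂(W)`
contains a non-zero class dying on `Γ_{ℚ(E[4])}` — the level-`4` inflation class `ξ_W` («`W` Selmer-entangled»). Such a class is
automatically UNRAMIFIED at every odd prime of good reduction (its cocycle vanishes on the inertia groups there, which fix `E[4]`), and
at a good `v ∤ 2` the Kummer condition IS the unramified subgroup (Lemma 2.10 (v) / X11b `kummerSelmerStructure_inr_eq_unramifiedSubgroup`);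
at the infinite place `H¹(ℝ, E[2]) = 0` for `Δ_W < 0`. Hence:

* `localization_mem_kummer_of_forall_torsionFixing_four_h1Eval_eq_zero` — a class of `H¹(ℚ, W[2])` dying on `Γ_{ℚ(E[4])}` satisfies the
  Kummer condition at every finite `v ∤ 2` of good reduction;
* `mem_selmerGroup_iff_local_of_forall_torsionFixing_four_h1Eval_eq_zero` — for `Δ_W < 0`, such a class lies in `Sel₂(W)` IFF it satisfies
  the Kummer condition at the finitely many finite places `v` with `v ∣ 2` or `W` bad at `v`. So «`W` Selmer-entangled» is a LOCAL condition on
  the `GL₂(ℤ/4)`-extension `ℚ(E[4])/ℚ` at `2N` (census-ready; 0 kit here).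

References: [MazurRubin2010] Lemma 2.10 (v), Def. 3.1; [LawsonWuthrich2016] §3; [SilvermanAEC2009] VII.4.1, X.4; [MilneADT2006] I §6.
-/

set_option linter.dupNamespace false -- tree convention: `Summit.BirchSwinnertonDyer.BirchSwinnertonDyer.Theorems` (summit = sub-problem)
set_option autoImplicit false

noncomputable section

open scoped Classical Pointwise ContRepresentation

namespace Summit.BirchSwinnertonDyer.BirchSwinnertonDyer.Theorems.GenusKolyTwistingPrime

open WeierstrassCurve NumberField IsDedekindDomain Field Function
open Literature.NumberTheory.GaloisRepresentations Literature.NumberTheory.EllipticCurves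
open Literature.NumberTheory
open Literature.NumberTheory.GaloisRepresentations.DiscreteGaloisModule (SelmerStructure unramifiedSubgroup)
open Literature.NumberTheory.GaloisCohomology
open Summit.BirchSwinnertonDyer.BirchSwinnertonDyer.Theorems.GenusKolyTwistLocal
open Rat.HeightOneSpectrum (primesEquiv natGenerator)

/-! ## §49 Selmer membership of a class dying on `Γ_{ℚ(E[4])}` is decided at `2N` -/

section SelmerLocal

variable (W : WeierstrassCurve ℚ) [W.IsElliptic]

/-- `4 ∉ v` for a finite place `v ∤ 2` (the ideal is prime). [folklore] -/
theorem intCast_four_not_mem_of_two_not_mem (v : HeightOneSpectrum (𝓞 ℚ)) (h2v : ((2 : ℕ) : 𝓞 ℚ) ∉ v.asIdeal) :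
    ((4 : ℤ) : 𝓞 ℚ) ∉ v.asIdeal := by
  intro h4
  have e : ((4 : ℤ) : 𝓞 ℚ) = ((2 : ℕ) : 𝓞 ℚ) * ((2 : ℕ) : 𝓞 ℚ) := by push_cast; norm_num
  rw [e] at h4
  rcases v.isPrime.mem_or_mem h4 with h | h <;> exact h2v h

/-- **A class dying on `Γ_{ℚ(E[4])}` satisfies the Kummer condition at every good `v ∤ 2`.** For `W/ℚ` elliptic, `v` a finite
place with `v ∤ 2` and good reduction, and `x ∈ H¹(ℚ, W[2])` with `[x, h] = 0` for all `h ∈ Γ_{ℚ(E[4])}`: `loc_v x ∈ 𝓛_W(ℚ_v)`.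
Indeed the inertia group at `v` fixes `E[4]` (`inertia_le_torsionFixing`), so the cocycle of `x` vanishes on it and `loc_v x` is
unramified (`localization_mem_unramifiedSubgroup_of_forall_inertia`), and `𝓛_W(ℚ_v) = H¹_ur` at a good `v ∤ 2` (the lead's
`kummerLocalConditionAt_two_eq_unramifiedSubgroup`, X11b Lemma 2.10 (v)). [cite: MazurRubin2010, Lemma 2.10 (v) (arXiv:0904.3709 p. 7)]
[cite: SilvermanAEC2009, Prop. VII.4.1] [cite: MilneADT2006, Ch. I §6] -/
theorem localization_mem_kummer_of_forall_torsionFixing_four_h1Eval_eq_zero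
    (v : HeightOneSpectrum (𝓞 ℚ)) (h2v : ((2 : ℕ) : 𝓞 ℚ) ∉ v.asIdeal) (hW : W.HasGoodReductionAt v)
    {x : galoisCohomology (W.torsionGaloisModule ((2 : ℕ) : ℤ)) 1}
    (hx : ∀ h ∈ torsionFixing W (4 : ℤ), h1Eval W ((2 : ℕ) : ℤ) x h = 0) :
    galoisCohomology.localization (W.torsionGaloisModule ((2 : ℕ) : ℤ)) (Sum.inr v) 1 x ∈
      W.kummerLocalConditionAt ((2 : ℕ) : ℤ) (v.adicCompletion ℚ) := by
  have hvbad : v ∉ W.badPlaces (𝓞 ℚ) := fun h ↦ h hW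
  have h4v := intCast_four_not_mem_of_two_not_mem v h2v
  obtain ⟨𝔐, h𝔐⟩ := v.localPrimesAbove_nonempty
  have hI : (adicCompletionPrime ℚ v).inertia (absoluteGaloisGroup ℚ) ≤ torsionFixing W (4 : ℤ) := by
    rw [← Summit.BirchSwinnertonDyer.Rank1Residual.X11b.AcSelmer.primeBelow_closureEmb_eq_adicCompletionPrime v h𝔐]
    exact inertia_le_torsionFixing W hvbad h4v _ h𝔐
  have hur : galoisCohomology.localization (W.torsionGaloisModule ((2 : ℕ) : ℤ)) (Sum.inr v) 1 x ∈
      unramifiedSubgroup (GaloisRep.toLocal v (W.torsionGaloisModule ((2 : ℕ) : ℤ))) 1 := by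
    have h := KolyvaginRoadThreePT.localization_mem_unramifiedSubgroup_of_forall_inertia
      (W.torsionGaloisModule ((2 : ℕ) : ℤ)) (reprCocycle W ((2 : ℕ) : ℤ) x) v (fun g hg ↦ hx g (hI hg))
    have e : oneCocycleClass (W.torsionGaloisModule ((2 : ℕ) : ℤ)).toTopRep (reprCocycle W ((2 : ℕ) : ℤ) x) = x :=
      oneCocycleClass_reprCocycle W ((2 : ℕ) : ℤ) x
    rw [e] at h
    exact h
  rw [GenusKolyTwistRamified.kummerLocalConditionAt_two_eq_unramifiedSubgroup W v h2v hW]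
  exact hur

/-- **«`W` SELMER-ENTANGLED» IS DECIDED AT `2N`.** For `W/ℚ` elliptic with `Δ_W < 0` and a class `x ∈ H¹(ℚ, W[2])` dying on
`Γ_{ℚ(E[4])}`: `x ∈ Sel₂(W)` IFF `loc_v x ∈ 𝓛_W(ℚ_v)` at every finite place `v` with `v ∣ 2` or bad reduction. (At good `v ∤ 2`
the condition is automatic by `localization_mem_kummer_of_forall_torsionFixing_four_h1Eval_eq_zero`; at the infinite place
`H¹(ℝ, E[2]) = 0` for `Δ_W < 0`, gk2-p3's `localH1_infinitePlace_eq_zero_of_Δ_neg`.) With the entanglement criterion: whether ANY prime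
Heegner twin of `W` is entangled is decided by the local behaviour of the level-`4` class at `2N`.
[cite: MazurRubin2010, Lemma 2.10 (v), Def. 3.1 (arXiv:0904.3709 pp. 7, 9)] [cite: LawsonWuthrich2016, §3] [cite: MilneADT2006, Ch. I §6] -/
theorem mem_selmerGroup_iff_local_of_forall_torsionFixing_four_h1Eval_eq_zero (hΔ : W.Δ < 0)
    {x : galoisCohomology (W.torsionGaloisModule ((2 : ℕ) : ℤ)) 1}
    (hx : ∀ h ∈ torsionFixing W (4 : ℤ), h1Eval W ((2 : ℕ) : ℤ) x h = 0) :
    x ∈ (W.kummerSelmerStructure ((2 : ℕ) : ℤ)).selmerGroup ↔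
      ∀ v : HeightOneSpectrum (𝓞 ℚ), (((2 : ℕ) : 𝓞 ℚ) ∈ v.asIdeal ∨ ¬ W.HasGoodReductionAt v) →
        galoisCohomology.localization (W.torsionGaloisModule ((2 : ℕ) : ℤ)) (Sum.inr v) 1 x ∈
          W.kummerLocalConditionAt ((2 : ℕ) : ℤ) (v.adicCompletion ℚ) := by
  constructor
  · intro hS v _
    have h := (SelmerStructure.mem_selmerGroup_iff _ _).mp hS (Sum.inr v)
    rwa [kummerSelmerStructure_apply] at h
  · intro hloc
    rw [SelmerStructure.mem_selmerGroup_iff]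
    rintro (w | v)
    · -- infinite place: `H¹(ℝ, E(ℂ)) = 0` for `Δ < 0`, so the Kummer condition is everything
      rw [kummerSelmerStructure_apply]
      have hW' : ∀ y : galoisCohomology (W.localGaloisModule w.Completion) 1, y = 0 := fun y ↦
        GenusExact.ArchVanishing.localH1_infinitePlace_eq_zero_of_Δ_neg W w hΔ y
      have htop : W.kummerLocalConditionAt ((2 : ℕ) : ℤ) (Place.Completion (Sum.inl w)) = ⊤ :=
        kummerLocalConditionAt_eq_top_of_forall_eq_zero W _ _ hW'
      rw [htop]
      exact AddSubgroup.mem_top _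
    · rw [kummerSelmerStructure_apply]
      by_cases h : ((2 : ℕ) : 𝓞 ℚ) ∈ v.asIdeal ∨ ¬ W.HasGoodReductionAt v
      · exact hloc v h
      · push Not at h
        exact localization_mem_kummer_of_forall_torsionFixing_four_h1Eval_eq_zero W v h.1 h.2 hx

/-- **The `(2 : ℤ)`-spelling for Selmer classes of the series**: for `W/ℚ` elliptic with `Δ_W < 0`, a class `x ∈ H¹(ℚ, W[2])` dying on
`Γ_{ℚ(E[4])}` lies in `Sel₂(W)` as soon as it satisfies the Kummer condition at the places over `2` and the bad places. (Contrapositive,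
for the census: «`W` Selmer-DISentangled» — no non-zero `2`-Selmer class dies on `Γ_{ℚ(E[4])}` — holds iff the level-`4` inflation class
FAILS a Kummer condition at some `v ∣ 2N`.) [cite: MazurRubin2010, Lemma 2.10 (v), Def. 3.1] [cite: LawsonWuthrich2016, §3] -/
theorem mem_selmerGroup_of_local_of_forall_torsionFixing_four_h1Eval_eq_zero (hΔ : W.Δ < 0)
    {x : galoisCohomology (W.torsionGaloisModule ((2 : ℕ) : ℤ)) 1}
    (hx : ∀ h ∈ torsionFixing W (4 : ℤ), h1Eval W ((2 : ℕ) : ℤ) x h = 0)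
    (hloc : ∀ v : HeightOneSpectrum (𝓞 ℚ), (((2 : ℕ) : 𝓞 ℚ) ∈ v.asIdeal ∨ ¬ W.HasGoodReductionAt v) →
      galoisCohomology.localization (W.torsionGaloisModule ((2 : ℕ) : ℤ)) (Sum.inr v) 1 x ∈
        W.kummerLocalConditionAt ((2 : ℕ) : ℤ) (v.adicCompletion ℚ)) :
    x ∈ W.selmerGroup ((2 : ℕ) : ℤ) := by
  rw [selmerGroup_eq_selmerGroup_kummerSelmerStructure]
  exact (mem_selmerGroup_iff_local_of_forall_torsionFixing_four_h1Eval_eq_zero W hΔ hx).mpr hloc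

end SelmerLocal

end Summit.BirchSwinnertonDyer.BirchSwinnertonDyer.Theorems.GenusKolyTwistingPrime

end
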